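import Literature.AlgebraicGeometry.Resolution.BlowupCharts
import Literature.AlgebraicGeometry.Resolution.HypersurfaceTransformChart
import Literature.AlgebraicGeometry.Resolution.RegularBlowup
import Literature.AlgebraicGeometry.Resolution.StalkIdealLemmas
import HarnessLib

/-!
# The controlled transform of a hypersurface of maximal contact is a regular hypersurface (BGMW 2011, Lemma 3.6.4 (4), sheaf level)

Topic: `Literature/AlgebraicGeometry/Resolution`. Bierstone–Grigoriev–Milman–Włodarczyk, *Effective
Hironaka resolution and its complexity (with appendix on applications in positive
characteristic)*, arXiv:1206.3090, §3.6, **Lemma 3.6.4 (4)** (Giraud): for a marked ideal of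
maximal order, a blow-up `σ : X ← X'` at a smooth centre `C ⊂ supp(𝓘, μ)`, and a tangent
direction `u` of order one along `V(u)` (so `V(u) ⊇ supp ⊇ C`), on an open `U'` where the
exceptional divisor is described by `y` the controlled transform `u' := σᶜ(u) = y⁻¹σ^*(u)` has
"(4) `V(u')` is smooth" — printed proof: "Since `u` is one of the local parameters describing the
center of the blow-up, `u' = u/y` is a parameter; that is, a function of order one."

This file PROVES the statement at the level of schemes and ideal sheaves, for a blow-up in the
sense of the universal property (`IsBlowup π C`, `Blowups.lean`): if `X` is a locally
Noetherian regular scheme, `V(C)` is regular, and `H ⊆ C` is an ideal sheaf generated at each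
point of `V(H)` by an element of order one of the (regular) local ring (the ideal sheaf of the
hypersurface `V(u)`), then the controlled transform `H' = (π^*H : 𝓘(D))`
(`controlledTransform π C H 1`, i.e. `(u')` locally) is generated at each point `x'` of `V(H')`
by an element of order one of `𝒪_{X',x'}`
(`IsBlowup.exists_generator_notMem_sq_controlledTransform`; the sharper
`IsBlowup.exists_generator_controlledTransform_hypersurface` adds that this generator does not
divide the local equation of the exceptional divisor); as `X'` is regular (Liu
Thm. 8.1.19 (a), `RegularBlowup.lean`), `𝒪_{X',x'}/H'_{x'}` is a regular local ring of
dimension `dim 𝒪_{X',x'} - 1` — `V(u')` is a regular hypersurface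
(`IsBlowup.isRegularLocalRing_quotient_stalkIdeal_controlledTransform`).

Proof. Off the centre the blow-up is a local isomorphism and `H'_{x'} = π^*H_{π x'}`. At a
point over the centre: on an affine neighbourhood `C` is cut out by a quasi-regular sequence
`f` (`exists_isQuasiRegular_away_of_isRegularRing`, `RegularCentreLocal.lean`), a generator `u`
of `H_{π x'}` may be taken in `H(U)` (`exists_mem_span_singleton_eq`), `u = Σ a_l f_l`; through
`x'` passes a chart `V` with `Γ(X', V) ≅ (R[It])_{(f_i t)}` over `R = Γ(X, U)`
(`IsBlowup.exists_generator_chart`, the generator version of `BlowupCharts.lean`); there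
`C(U)·Γ(X', V) = (f_i)`, `π^*u = f_i · w₀`, the exceptional divisor is Cartier so `f_i` is a
nonzerodivisor in the stalk and `H'_{x'} = ((f_i w₀) : (f_i)) = (w₀)` (`stalkIdeal_colon`,
`stalkIdeal_comap_eq_map_stalkMap` of `StalkIdealLemmas.lean`, `colon_span_mul_span_singleton`); finally `w₀` is of order one by the chart
computation `chartTransform_notMem_sq` (`HypersurfaceTransformChart.lean`: `û = Σ φ(a_l) e_l` is
of order one wherever it vanishes on the exceptional divisor, `u` being of order one below),
transported from `B_{e(𝔮)}` to the stalk `𝒪_{X',x'} = Γ(X', V)_𝔮`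
(`exists_ringEquiv_localization_map`, `notMem_sq_of_chart`).

Auxiliary [folklore]: `colon_span_mul_span_singleton`, `exists_mem_span_singleton_eq` (in a local
ring a principal ideal `span G` is generated by a member of `G`), `notMem_sq_of_span_singleton_eq`,
`notMem_sq_maximalIdeal_iff_of_ringEquiv`, `map_mem_nonZeroDivisors_of_isLocalization`,
`mem_nonZeroDivisors_of_span_singleton_eq`, `appLE_germ`, `stalkIdeal_colon` (stalks of colon ideal sheaves, locally Noetherian),
`exists_ringEquiv_localization_map`, `notMem_sq_of_chart`, `comap_primeIdealOf_appLE`,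
`IsBlowup.exists_generator_chartι`, `IsBlowup.exists_generator_chart`, `exists_chartTransform`,
`chartTransform_notMem_sq'`, `colon_coe_top`.

Not treated here: the identification of `V(H')` with the strict transform of `V(H)`, i.e. with
the blow-up of `V(H)` along `C` (Lemma 3.6.4 (6)).

## Sources

* [BGMW 2011] §3.6 Lemma 3.6.4 (4) and its proof (arXiv:1206.3090, p. 8).
  [BierstoneGrigorievMilmanWlodarczyk2011]
* Q. Liu, *Algebraic Geometry and Arithmetic Curves* (2002), Thm. 8.1.19 (a) — through
  `RegularBlowup.lean`. [Liu2002]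
* The Stacks Project, Tag 0804 (charts of the blow-up) — through `BlowupCharts.lean`,
  `BlowupChartQuasiRegular.lean`. [StacksProject]
-/

noncomputable section

open CategoryTheory CategoryTheory.Limits AlgebraicGeometry TopologicalSpace IsLocalRing

namespace Literature.AlgebraicGeometry.Resolution

universe u

/-! ## Ring-level lemmas -/

section Ring

variable {S T : Type*} [CommRing S] [CommRing T]

/-- `((a b) : (a)) = (b)` for a nonzerodivisor `a`. [folklore] -/
theorem colon_span_mul_span_singleton {a : S} (ha : a ∈ nonZeroDivisors S) (b : S) :
    Submodule.colon (Ideal.span {a * b}) (Ideal.span {a} : Set S) = Ideal.span {b} := by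
  rw [Submodule.colon_span]
  ext y
  rw [Submodule.mem_colon_singleton, smul_eq_mul, Ideal.mem_span_singleton,
    Ideal.mem_span_singleton]
  constructor
  · rintro ⟨c, hc⟩
    refine ⟨c, (mul_cancel_left_mem_nonZeroDivisors ha).mp ?_⟩
    rw [mul_comm a y, hc]
    ring
  · rintro ⟨c, rfl⟩
    exact ⟨c, by ring⟩

/-- In a local ring, a principal ideal generated by a set is generated by a member of the set.
[folklore] -/
theorem exists_mem_span_singleton_eq [IsLocalRing S] {G : Set S} (hG : G.Nonempty) {v : S}
    (h : Ideal.span G = Ideal.span {v}) : ∃ g ∈ G, Ideal.span {g} = Ideal.span {v} := by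
  classical
  have hv : v ∈ Ideal.span G := by rw [h]; exact Ideal.mem_span_singleton_self v
  obtain ⟨l, hl⟩ := (Finsupp.mem_span_iff_linearCombination S G v).mp
    (show v ∈ Submodule.span S G from hv)
  -- each `g ∈ G` is `t_g • v`
  have ht : ∀ g : G, ∃ t : S, (g : S) = t * v := fun g => by
    have : (g : S) ∈ Ideal.span {v} := by rw [← h]; exact Ideal.subset_span g.2
    obtain ⟨t, ht⟩ := Ideal.mem_span_singleton'.mp this
    exact ⟨t, ht.symm⟩
  choose t ht using ht
  by_cases hunit : ∃ g : G, IsUnit (t g)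
  · obtain ⟨g, hg⟩ := hunit
    refine ⟨g, g.2, le_antisymm ?_ ?_⟩
    · rw [Ideal.span_singleton_le_iff_mem, ← h]
      exact Ideal.subset_span g.2
    · rw [Ideal.span_singleton_le_iff_mem, Ideal.mem_span_singleton']
      obtain ⟨w, hw⟩ := hg
      refine ⟨(↑w⁻¹ : S), ?_⟩
      rw [ht g, ← hw, ← mul_assoc, Units.inv_mul, one_mul]
  · -- all `t_g ∈ 𝔪`: then `v = (Σ l_g t_g) v` forces `v = 0`
    push Not at hunit
    have hsum : v = (l.sum fun g c => c * t g) * v := by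
      conv_lhs => rw [← hl]
      rw [Finsupp.linearCombination_apply, Finsupp.sum_mul]
      refine Finset.sum_congr rfl fun g _ => ?_
      change l g • (g : S) = l g * t g * v
      rw [smul_eq_mul, ht g, mul_assoc]
    have hm : (l.sum fun g c => c * t g) ∈ maximalIdeal S := by
      refine Submodule.sum_mem _ fun g _ => Ideal.mul_mem_left _ _ ?_
      exact (mem_maximalIdeal _).mpr (hunit g)
    have hv0 : v = 0 := by
      have h1 : (1 - l.sum fun g c => c * t g) * v = 0 := by
        rw [sub_mul, one_mul, ← hsum, sub_self]
      have hu : IsUnit (1 - l.sum fun g c => c * t g) :=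
        (isUnit_or_isUnit_one_sub_self _).resolve_left ((mem_maximalIdeal _).mp hm)
      exact (hu.mul_right_eq_zero).mp h1
    obtain ⟨g, hg⟩ := hG
    refine ⟨g, hg, ?_⟩
    have hg0 : g = 0 := by
      have := ht ⟨g, hg⟩
      rw [hv0, mul_zero] at this
      exact this
    rw [hg0, hv0]

/-- Generators of the same principal ideal are simultaneously (not) in `𝔪²`. [folklore] -/
theorem notMem_sq_of_span_singleton_eq [IsLocalRing S] {v w : S}
    (h : Ideal.span {v} = Ideal.span {w}) (hv : v ∉ (maximalIdeal S) ^ 2) :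
    w ∉ (maximalIdeal S) ^ 2 := fun hw =>
  hv ((Ideal.span_singleton_le_iff_mem _).mp
    (h.le.trans ((Ideal.span_singleton_le_iff_mem _).mpr hw)))

/-- Ring isomorphisms of local rings preserve "of order one". [folklore] -/
theorem notMem_sq_maximalIdeal_iff_of_ringEquiv [IsLocalRing S] [IsLocalRing T] (e : S ≃+* T)
    (v : S) : v ∉ (maximalIdeal S) ^ 2 ↔ e v ∉ (maximalIdeal T) ^ 2 := by
  rw [← map_ringEquiv_maximalIdeal e, ← Ideal.map_pow, not_iff_not]
  constructor
  · intro hv; exact Ideal.mem_map_of_mem _ hv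
  · intro hv
    have := (Ideal.symm_apply_mem_of_equiv_iff (f := e)).mpr hv
    rwa [e.symm_apply_apply] at this

/-- A nonzerodivisor stays a nonzerodivisor in a localization. [folklore] -/
theorem map_mem_nonZeroDivisors_of_isLocalization (M : Submonoid S) (L : Type*) [CommRing L]
    [Algebra S L] [IsLocalization M L] {a : S} (ha : a ∈ nonZeroDivisors S) :
    algebraMap S L a ∈ nonZeroDivisors L :=
  IsLocalization.nonZeroDivisors_le_comap M L ha

/-- A generator of a principal ideal that is also generated by a nonzerodivisor is a
nonzerodivisor (the two generators differ by a unit). [folklore] -/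
theorem mem_nonZeroDivisors_of_span_singleton_eq {t t₀ : S}
    (h : Ideal.span {t} = Ideal.span {t₀}) (ht₀ : t₀ ∈ nonZeroDivisors S) :
    t ∈ nonZeroDivisors S := by
  have ht : t ∈ Ideal.span {t₀} := h ▸ Ideal.mem_span_singleton_self t
  have ht₀' : t₀ ∈ Ideal.span {t} := h.symm ▸ Ideal.mem_span_singleton_self t₀
  obtain ⟨a, ha⟩ := Ideal.mem_span_singleton'.mp ht
  obtain ⟨b, hb⟩ := Ideal.mem_span_singleton'.mp ht₀'
  have h2 : b * a = 1 := by
    have h1 : (b * a - 1) * t₀ = 0 := by rw [sub_mul, one_mul, mul_assoc, ha, hb, sub_self]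
    exact sub_eq_zero.mp ((mem_nonZeroDivisors_iff_right.mp ht₀) _ h1)
  have hau : IsUnit a := isUnit_iff_exists_inv.mpr ⟨b, by rw [mul_comm, h2]⟩
  rw [← ha]
  exact mul_mem_nonZeroDivisors.mpr ⟨hau.mem_nonZeroDivisors, ht₀⟩

end Ring

/-! ## Stalks of inverse images and of colon ideal sheaves -/

section Stalks

variable {X Y : Scheme.{u}}

/-- `π^*` on sections followed by the germ is the germ followed by the stalk map. [folklore] -/
theorem appLE_germ (f : X ⟶ Y) (U : Y.Opens) (V : X.Opens) (e : V ≤ f ⁻¹ᵁ U) (x : X)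
    (hxV : x ∈ V) :
    f.appLE U V e ≫ X.presheaf.germ V x hxV =
      Y.presheaf.germ U (f x) (e hxV) ≫ f.stalkMap x := by
  rw [Scheme.Hom.germ_stalkMap, Scheme.Hom.appLE, Category.assoc, X.presheaf.germ_res]

variable [IsLocallyNoetherian X]

/-- **Stalks of the colon ideal sheaf** (locally Noetherian scheme): `(L : P)_x = (L_x : P_x)`.
[folklore] -/
theorem stalkIdeal_colon (L P : X.IdealSheafData) (x : X) :
    stalkIdeal (colon L P) x = Submodule.colon (stalkIdeal L x) (stalkIdeal P x : Set _) := by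
  obtain ⟨U, hU, hxU, -⟩ :=
    exists_isAffineOpen_mem_and_subset (X := X) (x := x) (U := ⊤) (Opens.mem_top _)
  haveI : IsNoetherianRing Γ(X, U) := IsLocallyNoetherian.component_noetherian ⟨U, hU⟩
  letI : Algebra Γ(X, U) (X.presheaf.stalk x) := (X.presheaf.germ U x hxU).hom.toAlgebra
  haveI : IsLocalization.AtPrime (X.presheaf.stalk x) (hU.primeIdealOf ⟨x, hxU⟩).asIdeal :=
    hU.isLocalization_stalk ⟨x, hxU⟩
  rw [stalkIdeal_eq_map_germ _ ⟨U, hU⟩ hxU, stalkIdeal_eq_map_germ _ ⟨U, hU⟩ hxU,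
    stalkIdeal_eq_map_germ _ ⟨U, hU⟩ hxU, ideal_colon]
  exact Ideal.map_colon_of_fg (hU.primeIdealOf ⟨x, hxU⟩).asIdeal.primeCompl (X.presheaf.stalk x)
    _ _ (IsNoetherian.noetherian _)

end Stalks

/-! ## Localizations along a ring isomorphism of the base -/

section LocTransfer

variable {R' B S' : Type*} [CommRing R'] [CommRing B] [CommRing S'] [Algebra R' S']

/-- **Transfer of a localization at a prime along a ring isomorphism of the base**: if `S'` is
the localization of `R'` at the prime `𝔮` and `e : R' ≅ B`, then `S'` is isomorphic to the
localization of `B` at `e(𝔮)`, compatibly with the structure maps. [folklore] -/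
theorem exists_ringEquiv_localization_map (e : R' ≃+* B) (𝔮 : Ideal R') [𝔮.IsPrime]
    [IsLocalization.AtPrime S' 𝔮] :
    ∃ ε : S' ≃+* Localization.AtPrime (𝔮.map e),
      ∀ r : R', ε (algebraMap R' S' r) = algebraMap B (Localization.AtPrime (𝔮.map e)) (e r) := by
  letI algB : Algebra B S' := ((algebraMap R' S').comp e.symm.toRingHom).toAlgebra
  have halg : ∀ b : B, algebraMap B S' b = algebraMap R' S' (e.symm b) := fun b => rfl
  have hloc : @IsLocalization B _ (Submonoid.map e.toMonoidHom 𝔮.primeCompl) S' _ algB :=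
    IsLocalization.isLocalization_of_base_ringEquiv 𝔮.primeCompl S' e
  have hM : Submonoid.map e.toMonoidHom 𝔮.primeCompl = (𝔮.map e).primeCompl := by
    ext y
    constructor
    · rintro ⟨z, hz, rfl⟩ hy
      apply hz
      have := (Ideal.symm_apply_mem_of_equiv_iff (f := e)).mpr hy
      rwa [show e.symm (e.toMonoidHom z) = z from e.symm_apply_apply z] at this
    · intro hy
      exact ⟨e.symm y, fun h => hy ((Ideal.symm_apply_mem_of_equiv_iff (f := e)).mp h),
        e.apply_symm_apply y⟩
  haveI : @IsLocalization B _ (𝔮.map e).primeCompl S' _ algB := by rw [← hM]; exact hloc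
  let ε : S' ≃ₐ[B] Localization.AtPrime (𝔮.map e) :=
    IsLocalization.algEquiv (𝔮.map e).primeCompl S' (Localization.AtPrime (𝔮.map e))
  refine ⟨ε.toRingEquiv, fun r => ?_⟩
  have h1 : algebraMap R' S' r = algebraMap B S' (e r) := by rw [halg, e.symm_apply_apply]
  rw [h1]
  exact ε.commutes (e r)

/-- **The generic transfer step of Lemma 3.6.4 (4)**: let `S'` be the local ring of `R'` at the
prime `𝔮`, `e : R' ≅ B` an isomorphism with a "chart ring" `B` receiving `φ : R → B` with
`e ∘ ψ = φ`, and `û ∈ B`. If the chart computation says that `û` is of order one at every prime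
`Q` of `B` containing `φ(b₀)` and `û` over which `u ∈ R` is of order one, and if at `𝔮` indeed
`ψ(b₀), e⁻¹(û) ∈ 𝔪` and `u` is of order one below, then `e⁻¹(û)/1 ∈ S'` is of order one.
[folklore] -/
theorem notMem_sq_of_chart {R : Type*} [CommRing R] [IsLocalRing S'] (𝔮 : Ideal R') [𝔮.IsPrime]
    [IsLocalization.AtPrime S' 𝔮] (e : R' ≃+* B) (ψ : R →+* R') (φ : R →+* B)
    (hφ : ∀ s : R, e (ψ s) = φ s) (b₀ : R) (û : B) (u : R)
    (hchart : ∀ (Q : Ideal B) [Q.IsPrime], φ b₀ ∈ Q → û ∈ Q →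
      algebraMap R (Localization.AtPrime (Q.comap φ)) u ∉
          (maximalIdeal (Localization.AtPrime (Q.comap φ))) ^ 2 →
        algebraMap B (Localization.AtPrime Q) û ∉ (maximalIdeal (Localization.AtPrime Q)) ^ 2)
    (ht : algebraMap R' S' (ψ b₀) ∈ maximalIdeal S')
    (hw : algebraMap R' S' (e.symm û) ∈ maximalIdeal S')
    (hu : ∀ (P : Ideal R) [P.IsPrime], P = 𝔮.comap ψ →
      algebraMap R (Localization.AtPrime P) u ∉ (maximalIdeal (Localization.AtPrime P)) ^ 2) :
    algebraMap R' S' (e.symm û) ∉ (maximalIdeal S') ^ 2 := by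
  obtain ⟨ε, hε⟩ := exists_ringEquiv_localization_map (S' := S') e 𝔮
  rw [notMem_sq_maximalIdeal_iff_of_ringEquiv ε, hε, e.apply_symm_apply]
  have hmem : ∀ r : R', algebraMap R' S' r ∈ maximalIdeal S' → e r ∈ 𝔮.map e := fun r hr => by
    rw [← Ideal.symm_apply_mem_of_equiv_iff, e.symm_apply_apply]
    exact (IsLocalization.AtPrime.to_map_mem_maximal_iff S' 𝔮 r).mp hr
  have hQt : φ b₀ ∈ 𝔮.map e := by rw [← hφ]; exact hmem _ ht
  have hQw : û ∈ 𝔮.map e := by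
    have := hmem _ hw
    rwa [e.apply_symm_apply] at this
  refine hchart _ hQt hQw (hu _ ?_)
  ext s
  rw [Ideal.mem_comap, Ideal.mem_comap, ← hφ, ← Ideal.symm_apply_mem_of_equiv_iff,
    e.symm_apply_apply]

/-- The companion transfer step for the RELATIVE chart statement ("`x_i ∉ (û)·B_Q`"): under the
same setup, if the chart computation gives `φ(b₀) ∉ (û)·B_Q` at every relevant prime, then
`ψ(b₀)/1 ∉ (e⁻¹(û)/1) ⊆ S'`. [folklore] -/
theorem notMem_span_of_chart {R : Type*} [CommRing R] [IsLocalRing S'] (𝔮 : Ideal R') [𝔮.IsPrime]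
    [IsLocalization.AtPrime S' 𝔮] (e : R' ≃+* B) (ψ : R →+* R') (φ : R →+* B)
    (hφ : ∀ s : R, e (ψ s) = φ s) (b₀ : R) (û : B) (u : R)
    (hchart : ∀ (Q : Ideal B) [Q.IsPrime], φ b₀ ∈ Q → û ∈ Q →
      algebraMap R (Localization.AtPrime (Q.comap φ)) u ∉
          (maximalIdeal (Localization.AtPrime (Q.comap φ))) ^ 2 →
        algebraMap B (Localization.AtPrime Q) (φ b₀) ∉
          Ideal.span {algebraMap B (Localization.AtPrime Q) û})
    (ht : algebraMap R' S' (ψ b₀) ∈ maximalIdeal S')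
    (hw : algebraMap R' S' (e.symm û) ∈ maximalIdeal S')
    (hu : ∀ (P : Ideal R) [P.IsPrime], P = 𝔮.comap ψ →
      algebraMap R (Localization.AtPrime P) u ∉ (maximalIdeal (Localization.AtPrime P)) ^ 2) :
    algebraMap R' S' (ψ b₀) ∉ Ideal.span {algebraMap R' S' (e.symm û)} := by
  obtain ⟨ε, hε⟩ := exists_ringEquiv_localization_map (S' := S') e 𝔮
  have hmem : ∀ r : R', algebraMap R' S' r ∈ maximalIdeal S' → e r ∈ 𝔮.map e := fun r hr => by
    rw [← Ideal.symm_apply_mem_of_equiv_iff, e.symm_apply_apply]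
    exact (IsLocalization.AtPrime.to_map_mem_maximal_iff S' 𝔮 r).mp hr
  have hQt : φ b₀ ∈ 𝔮.map e := by rw [← hφ]; exact hmem _ ht
  have hQw : û ∈ 𝔮.map e := by
    have := hmem _ hw
    rwa [e.apply_symm_apply] at this
  have hcomap : (𝔮.map e).comap φ = 𝔮.comap ψ := by
    ext s
    rw [Ideal.mem_comap, Ideal.mem_comap, ← hφ, ← Ideal.symm_apply_mem_of_equiv_iff,
      e.symm_apply_apply]
  have h := hchart _ hQt hQw (hu _ hcomap)
  intro hmem'
  apply h
  have h1 := Ideal.mem_map_of_mem ε hmem'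
  rw [Ideal.map_span, Set.image_singleton, hε, hε, e.apply_symm_apply, hφ] at h1
  exact h1

end LocTransfer

/-! ## Points: the prime of `π x'` below the prime of `x'` -/

section Points

variable {X X' : Scheme.{u}} (π : X' ⟶ X)

/-- The point of `Spec Γ(X, U)` of `π x'` is the image of the point of `Spec Γ(X', V)` of `x'`
under `Spec (π^*)`. [folklore] -/
theorem comap_primeIdealOf_appLE (U : X.affineOpens) (V : X'.affineOpens)
    (hVU : (V : X'.Opens) ≤ π ⁻¹ᵁ (U : X.Opens)) (x' : X') (hx' : x' ∈ (V : X'.Opens)) :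
    (V.2.primeIdealOf ⟨x', hx'⟩).asIdeal.comap (π.appLE U V hVU).hom =
      (U.2.primeIdealOf ⟨π x', hVU hx'⟩).asIdeal := by
  have h := IsAffineOpen.SpecMap_appLE_fromSpec π U.2 V.2 hVU
  have h1 : U.2.fromSpec (Spec.map (π.appLE U V hVU) (V.2.primeIdealOf ⟨x', hx'⟩)) = π x' := by
    rw [← Scheme.Hom.comp_apply, h, Scheme.Hom.comp_apply, IsAffineOpen.fromSpec_primeIdealOf]
  have h2 : U.2.fromSpec (U.2.primeIdealOf ⟨π x', hVU hx'⟩) = π x' :=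
    IsAffineOpen.fromSpec_primeIdealOf _ _
  have h3 : Spec.map (π.appLE U V hVU) (V.2.primeIdealOf ⟨x', hx'⟩) =
      U.2.primeIdealOf ⟨π x', hVU hx'⟩ :=
    U.2.fromSpec.isOpenEmbedding.injective (h1.trans h2.symm)
  rw [← h3]
  rfl

end Points

/-! ## Charts at generators -/

section GeneratorChart

variable {X' X : Scheme.{u}} {π : X' ⟶ X} {C : X.IdealSheafData}

/-- The chart immersion at a generator through a given point (cf. `IsBlowup.exists_chartι_of_mem`,
here with the cover by the charts `D₊(f_i t)` at a family of generators `f` of `C(U)`).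
[cite: StacksProject, Tag 0804] -/
theorem IsBlowup.exists_generator_chartι (hπ : IsBlowup π C) (U : X.affineOpens) {x' : X'}
    (hxU : π x' ∈ (U : X.Opens)) {c : ℕ} (f : Fin c → Γ(X, U))
    (hf : Ideal.span (Set.range f) = C.ideal U) :
    ∃ (i : Fin c) (g : Spec (.of (HomogeneousLocalization.Away
        (reesGrading (Ideal.span (Set.range f)))
        (reesT (f i) (Ideal.mem_span_range_self (f := f) (x := i))))) ⟶ X'),
      IsOpenImmersion g ∧ x' ∈ Set.range g ∧
        g ≫ π = Spec.map (CommRingCat.ofHom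
          (reesChartBase (f i) (Ideal.mem_span_range_self (f := f) (x := i)))) ≫ U.2.fromSpec := by
  classical
  have h1 := hπ.restrict_isoSpec U
  rw [← hf] at h1
  obtain ⟨ε, -, hε'⟩ := h1.unique (affineBlowup.isBlowup (Ideal.span (Set.range f)))
  have hy : ε.hom ⟨x', hxU⟩ ∈ (⊤ : (affineBlowup (Ideal.span (Set.range f))).Opens) := trivial
  rw [← affineBlowup.iSup_basicOpen_reesT_generators_eq_top f] at hy
  obtain ⟨i, hyi⟩ := Opens.mem_iSup.mp hy
  refine ⟨i, affineBlowup.chartι (f i) (Ideal.mem_span_range_self (f := f) (x := i)) ≫ ε.inv ≫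
    (π ⁻¹ᵁ (U : X.Opens)).ι, inferInstance, ?_, ?_⟩
  · have hyb' : ε.hom ⟨x', hxU⟩ ∈
        affineBlowup.chartι (f i) (Ideal.mem_span_range_self (f := f) (x := i)) ''ᵁ ⊤ := by
      rwa [affineBlowup.image_top_chartι]
    obtain ⟨z, -, hz⟩ := hyb'
    replace hz : affineBlowup.chartι (f i) (Ideal.mem_span_range_self (f := f) (x := i)) z =
      ε.hom ⟨x', hxU⟩ := hz
    refine ⟨z, ?_⟩
    rw [Scheme.Hom.comp_apply, hz, ← Scheme.Hom.comp_apply, Iso.hom_inv_id_assoc]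
    rfl
  · rw [Category.assoc, Category.assoc, ← morphismRestrict_ι, ← U.2.isoSpec_hom_fromSpec,
      ← affineBlowup.chartι_π (f i), ← hε']
    simp only [Category.assoc]

/-- **Charts of a blow-up at a family of generators**: if `C(U) = (f_1, …, f_c)` on the affine
open `U ∋ π x'`, then `x'` lies in an affine open `V ⊆ π⁻¹(U)` with
`Γ(X', V) ≅ (R[It])_{(f_i t)}` over `R = Γ(X, U)` for some `i` (the charts `D₊(f_i t)` at the
generators cover `Proj R[It]`, `affineBlowup.iSup_basicOpen_reesT_generators_eq_top`).
[cite: StacksProject, Tag 0804] -/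
theorem IsBlowup.exists_generator_chart (hπ : IsBlowup π C) (U : X.affineOpens) {x' : X'}
    (hxU : π x' ∈ (U : X.Opens)) {c : ℕ} (f : Fin c → Γ(X, U))
    (hf : Ideal.span (Set.range f) = C.ideal U) :
    ∃ (i : Fin c) (V : X'.affineOpens) (hVU : (V : X'.Opens) ≤ π ⁻¹ᵁ (U : X.Opens))
      (e : Γ(X', V) ≃+* HomogeneousLocalization.Away (reesGrading (Ideal.span (Set.range f)))
        (reesT (f i) (Ideal.mem_span_range_self (f := f) (x := i)))),
      x' ∈ (V : X'.Opens) ∧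
        ∀ r : Γ(X, U), e (π.appLE U V hVU r) =
          reesChartBase (f i) (Ideal.mem_span_range_self (f := f) (x := i)) r := by
  obtain ⟨i, g, hg, hx', hgπ⟩ := hπ.exists_generator_chartι U hxU f hf
  haveI := hg
  have hVU := image_top_le_preimage_of_comp_eq π g U _ hgπ
  have key := appLE_appIso_ΓSpecIso_of_comp_eq π g U _ hgπ hVU
  refine ⟨i, ⟨g ''ᵁ ⊤, (isAffineOpen_top _).image_of_isOpenImmersion g⟩, hVU,
    ((g.appIso ⊤) ≪≫ Scheme.ΓSpecIso _).commRingCatIsoToRingEquiv, ?_, ?_⟩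
  · obtain ⟨z, rfl⟩ := hx'
    exact ⟨z, trivial, rfl⟩
  · intro r
    have key' := congrArg (fun φ : Γ(X, U) ⟶ _ => φ.hom r) key
    exact key'

end GeneratorChart

/-! ## The chart computation, packaged -/

section ChartPackage

variable {R : Type u} [CommRing R] {r : ℕ} (x : Fin r → R) (i : Fin r)

local notation3 "I" => Ideal.span (Set.range x)
local notation3 "B" => HomogeneousLocalization.Away (reesGrading I)
  (reesT (x i) (Ideal.mem_span_range_self (f := x) (x := i)))
local notation3 "φ" => reesChartBase (x i) (Ideal.mem_span_range_self (f := x) (x := i))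
local notation3 "e[" j "]" =>
  HomogeneousLocalization.Away.mk (reesGrading I)
    (reesT_mem (x i) (Ideal.mem_span_range_self (f := x) (x := i))) 1
    (reesT (x j) (Ideal.mem_span_range_self (f := x) (x := j))) (reesT_mem_one_smul x j)

/-- The chart-level input (`HypersurfaceTransformChart.lean`) packaged: the controlled transform
`û` of `u = Σ a_l x_l` on the chart at `x_i` with `φ(u) = φ(x_i) û`, of order one wherever it
vanishes on the exceptional divisor, provided `u` is of order one below.
[cite: BierstoneGrigorievMilmanWlodarczyk2011, Lemma 3.6.4 (4)] -/
theorem exists_chartTransform (hx : IsQuasiRegular x) (a : Fin r → R) :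
    ∃ û : B, φ (∑ l, a l * x l) = φ (x i) * û ∧
      ∀ (Q : Ideal B) [Q.IsPrime], φ (x i) ∈ Q → û ∈ Q →
        algebraMap R (Localization.AtPrime (Q.comap φ)) (∑ l, a l * x l) ∉
            (maximalIdeal (Localization.AtPrime (Q.comap φ))) ^ 2 →
          (algebraMap B (Localization.AtPrime Q) : B →+* Localization.AtPrime Q) û ∉
            (maximalIdeal (Localization.AtPrime Q)) ^ 2 :=
  ⟨_, reesChartBase_sum_mul_eq x i a, fun Q _ hQi hûQ hu2 =>
    chartTransform_notMem_sq x i hx Q hQi a hûQ hu2⟩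

/-- The same for any `û'` with `φ(u) = φ(x_i) û'` (`φ(x_i)` is a nonzerodivisor, so `û' = û`).
[cite: BierstoneGrigorievMilmanWlodarczyk2011, Lemma 3.6.4 (4)] -/
theorem chartTransform_notMem_sq' (hx : IsQuasiRegular x) (a : Fin r → R) (û' : B)
    (hû' : φ (∑ l, a l * x l) = φ (x i) * û') (Q : Ideal B) [Q.IsPrime] (hQi : φ (x i) ∈ Q)
    (hûQ : û' ∈ Q)
    (hu2 : algebraMap R (Localization.AtPrime (Q.comap φ)) (∑ l, a l * x l) ∉
      (maximalIdeal (Localization.AtPrime (Q.comap φ))) ^ 2) :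
    (algebraMap B (Localization.AtPrime Q) : B →+* Localization.AtPrime Q) û' ∉
      (maximalIdeal (Localization.AtPrime Q)) ^ 2 := by
  have h := hû'
  rw [reesChartBase_sum_mul_eq x i a] at h
  have hû : û' = ∑ l, φ (a l) * e[l] := ((mul_cancel_left_mem_nonZeroDivisors
    (reesChartBase_mem_nonZeroDivisors (x i) (Ideal.mem_span_range_self (f := x) (x := i)))).mp
      h).symm
  subst hû
  exact chartTransform_notMem_sq x i hx Q hQi a hûQ hu2

/-- The relative statement for any `û'` with `φ(u) = φ(x_i) û'`: `x_i ∉ (û')·B_Q` (`R/I` regular).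
[cite: BierstoneGrigorievMilmanWlodarczyk2011, Lemma 3.6.4 (4), (6)] -/
theorem reesChartBase_notMem_span_chartTransform' (hx : IsQuasiRegular x) [IsRegularRing (R ⧸ I)]
    (a : Fin r → R) (û' : B) (hû' : φ (∑ l, a l * x l) = φ (x i) * û') (Q : Ideal B) [Q.IsPrime]
    (hQi : φ (x i) ∈ Q) (hûQ : û' ∈ Q)
    (hu2 : algebraMap R (Localization.AtPrime (Q.comap φ)) (∑ l, a l * x l) ∉
      (maximalIdeal (Localization.AtPrime (Q.comap φ))) ^ 2) :
    (algebraMap B (Localization.AtPrime Q) : B →+* Localization.AtPrime Q) (φ (x i)) ∉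
      Ideal.span {(algebraMap B (Localization.AtPrime Q) : B →+* Localization.AtPrime Q) û'} := by
  have h := hû'
  rw [reesChartBase_sum_mul_eq x i a] at h
  have hû : û' = ∑ l, φ (a l) * e[l] := ((mul_cancel_left_mem_nonZeroDivisors
    (reesChartBase_mem_nonZeroDivisors (x i) (Ideal.mem_span_range_self (f := x) (x := i)))).mp
      h).symm
  subst hû
  exact reesChartBase_notMem_span_chartTransform x i hx Q hQi a hûQ hu2

end ChartPackage

/-! ## BGMW Lemma 3.6.4 (4) for a blow-up: the controlled transform of the hypersurface is a regular hypersurface -/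

section Main

variable {X X' : Scheme.{u}} [IsLocallyNoetherian X] {π : X' ⟶ X} {C H : X.IdealSheafData}

/-- `(N : univ) = N` for the colon by the unit ideal. [folklore] -/
theorem colon_coe_top {S : Type*} [CommRing S] (N : Ideal S) :
    Submodule.colon N ((⊤ : Ideal S) : Set S) = N := by
  ext y
  rw [Submodule.mem_colon]
  constructor
  · intro h
    simpa using h 1 trivial
  · intro hy p _
    rw [smul_eq_mul]
    exact N.mul_mem_right p hy

/-- **BGMW Lemma 3.6.4 (4), sheaf level, for a blow-up in the sense of the universal property**
("`u' = σᶜ(u) = y⁻¹σ^*(u)` … `V(u')` is smooth … since `u` is one of the local parameters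
describing the center of the blow-up, `u' = u/y` is a parameter; that is, a function of order
one"): let `X` be a locally Noetherian regular scheme, `π : X' → X` a blow-up along `C` with
`V(C)` regular, and `H ⊆ C` an ideal sheaf which at every point `x` of `V(H)` is generated by an
element of order one (`H_x = (v)`, `v ∉ 𝔪_x²`: the ideal of a hypersurface of maximal contact
through the centre, `MaximalContact.lean`). Then the controlled transform
`H' = (π^*H : 𝓘(D))` (`controlledTransform π C H 1`; locally `(u')`, `u' = y⁻¹π^*u`) is, at every
point `x'` of `V(H')`, generated by an element `w` of order one of the (regular) local ring
`𝒪_{X',x'}` — so `V(H')` is a regular hypersurface — which moreover does NOT divide the local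
equation of the exceptional divisor (`𝓘(D)_{x'} ⊄ (w)`: `V(H')` and `D` have no common component,
the input for the restriction property Lemma 3.6.4 (6)). Proof: off the centre `π` is a local
isomorphism and `H' = π^*H`; at a point over the centre, on an affine neighbourhood where `C` is
cut out by a quasi-regular sequence `f` (`exists_isQuasiRegular_away_of_isRegularRing`) and a
chart `Γ(X', V) ≅ (R[It])_{(f_i t)}` (`IsBlowup.exists_generator_chart`), `H_x = (u)` with
`u = Σ a_l f_l`, `H'_{x'} = ((f_i û) : (f_i)) = (û)` and `û` is of order one by the chart
computation (`chartTransform_notMem_sq`, `reesChartBase_notMem_span_chartTransform`,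
`HypersurfaceTransformChart.lean`). [cite: BierstoneGrigorievMilmanWlodarczyk2011, Lemma 3.6.4 (4)] -/
theorem IsBlowup.exists_generator_controlledTransform_hypersurface (hX : Scheme.IsRegular X)
    (hπ : IsBlowup π C) (hC : Scheme.IsRegular C.subscheme) (hHC : H ≤ C)
    (hH : ∀ x ∈ H.support, ∃ v : X.presheaf.stalk x,
      stalkIdeal H x = Ideal.span {v} ∧ v ∉ (maximalIdeal (X.presheaf.stalk x)) ^ 2)
    (x' : X') (hx' : x' ∈ (controlledTransform π C H 1).support) :
    ∃ w : X'.presheaf.stalk x', stalkIdeal (controlledTransform π C H 1) x' = Ideal.span {w} ∧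
      w ∉ (maximalIdeal (X'.presheaf.stalk x')) ^ 2 ∧
      ¬ stalkIdeal (C.comap π) x' ≤ Ideal.span {w} := by
  classical
  haveI : IsProper π := hπ.isProper
  haveI : IsLocallyNoetherian X' := LocallyOfFiniteType.isLocallyNoetherian π
  -- the stalk of `H'` as a colon
  have hH'st : stalkIdeal (controlledTransform π C H 1) x' =
      Submodule.colon ((stalkIdeal H (π x')).map (π.stalkMap x').hom)
        (stalkIdeal (C.comap π) x' : Set (X'.presheaf.stalk x')) := by
    rw [controlledTransform, pow_one, stalkIdeal_colon, stalkIdeal_comap_eq_map_stalkMap]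
  -- `π x' ∈ V(H)`
  have hxH : π x' ∈ H.support := by
    have h := Scheme.IdealSheafData.support_antitone (comap_le_controlledTransform π C H 1) hx'
    rwa [Scheme.IdealSheafData.support_comap] at h
  obtain ⟨v, hv, hv2⟩ := hH (π x') hxH
  have hwm : ∀ w : X'.presheaf.stalk x', stalkIdeal (controlledTransform π C H 1) x' =
      Ideal.span {w} → w ∈ maximalIdeal (X'.presheaf.stalk x') := fun w hw =>
    (Ideal.span_singleton_le_iff_mem _).mp (hw ▸ (mem_support_iff_stalkIdeal_le _ _).mp hx')
  by_cases hxC : π x' ∈ C.support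
  swap
  · /- off the centre: `π` is a local isomorphism and `H' = π^*H` at `x'` -/
    have htop : stalkIdeal (C.comap π) x' = ⊤ := by
      apply stalkIdeal_eq_top_of_not_mem_support
      rwa [Scheme.IdealSheafData.support_comap]
    rw [htop, colon_coe_top, hv, Ideal.map_span, Set.image_singleton] at hH'st
    -- the stalk map is an isomorphism
    set W₀ : X.Opens := ⟨(C.support : Set X)ᶜ, C.support.isClosed.isOpen_compl⟩ with hW₀
    haveI : IsIso (π ∣_ W₀) := hπ.isIso_compl
    have hx'W : x' ∈ π ⁻¹ᵁ W₀ := hxC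
    haveI : IsOpenImmersion ((π ⁻¹ᵁ W₀).ι ≫ π) := by
      rw [← morphismRestrict_ι]; infer_instance
    have h1 : IsIso (((π ⁻¹ᵁ W₀).ι ≫ π).stalkMap ⟨x', hx'W⟩) :=
      ((IsOpenImmersion.iff_isIso_stalkMap (f := (π ⁻¹ᵁ W₀).ι ≫ π)).mp inferInstance).2 _
    haveI h2 : IsIso (((π ⁻¹ᵁ W₀).ι).stalkMap ⟨x', hx'W⟩) :=
      ((IsOpenImmersion.iff_isIso_stalkMap (f := (π ⁻¹ᵁ W₀).ι)).mp inferInstance).2 _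
    rw [Scheme.Hom.stalkMap_comp] at h1
    haveI : IsIso (π.stalkMap x') :=
      @IsIso.of_isIso_comp_right _ _ _ _ _ (π.stalkMap x') (((π ⁻¹ᵁ W₀).ι).stalkMap ⟨x', hx'W⟩)
        h2 h1
    let ε : X.presheaf.stalk (π x') ≃+* X'.presheaf.stalk x' :=
      (asIso (π.stalkMap x')).commRingCatIsoToRingEquiv
    refine ⟨(π.stalkMap x').hom v, hH'st, (notMem_sq_maximalIdeal_iff_of_ringEquiv ε v).mp hv2, ?_⟩
    rw [htop, top_le_iff]
    intro heq
    exact (IsLocalRing.mem_maximalIdeal _).mp (hwm _ hH'st) (Ideal.span_singleton_eq_top.mp heq)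
  /- over the centre: an affine open `W ∋ π x'` and the local structure of `C` -/
  obtain ⟨W, hW, hxW, -⟩ :=
    exists_isAffineOpen_mem_and_subset (X := X) (x := π x') (U := ⊤) (Opens.mem_top _)
  haveI : IsNoetherianRing Γ(X, W) := IsLocallyNoetherian.component_noetherian ⟨W, hW⟩
  haveI : IsRegularRing Γ(X, W) := hX.isRegularRing_of_isAffineOpen hW
  haveI : IsRegularRing (Γ(X, W) ⧸ C.ideal ⟨W, hW⟩) := by
    have hreg : Scheme.IsRegular (Spec (C.subschemeCover.X ⟨W, hW⟩)) :=
      Scheme.IsRegular.of_isOpenImmersion (C.subschemeCover.f ⟨W, hW⟩) hC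
    exact (Scheme.isRegular_Spec_iff (.of (Γ(X, W) ⧸ C.ideal ⟨W, hW⟩))).mp hreg
  have hmemD : ∀ g : Γ(X, W), π x' ∈ X.basicOpen g ↔
      g ∉ (hW.primeIdealOf ⟨π x', hxW⟩).asIdeal := by
    intro g
    rw [← PrimeSpectrum.mem_basicOpen, ← hW.fromSpec_preimage_basicOpen g]
    change _ ↔ hW.fromSpec (hW.primeIdealOf ⟨π x', hxW⟩) ∈ X.basicOpen g
    rw [hW.fromSpec_primeIdealOf ⟨π x', hxW⟩]
  have hIp : C.ideal ⟨W, hW⟩ ≤ (hW.primeIdealOf ⟨π x', hxW⟩).asIdeal := by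
    intro a ha
    have hz := (Scheme.IdealSheafData.mem_support_iff_of_mem (I := C) (U := ⟨W, hW⟩) hxW).mp hxC
    rw [Scheme.mem_zeroLocus_iff] at hz
    by_contra hap
    exact hz a ha ((hmemD a).mpr hap)
  obtain ⟨g, hgp, c, f, hfI, hloc⟩ :=
    exists_isQuasiRegular_away_of_isRegularRing (C.ideal ⟨W, hW⟩) _ hIp
  -- the basic open `U = D(g) ∋ π x'`, where `C(U) = (f)` with `f` quasi-regular
  let U : X.affineOpens := X.affineBasicOpen (U := ⟨W, hW⟩) g
  have hxU : π x' ∈ (U : X.Opens) := (hmemD g).mpr hgp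
  let res := (X.presheaf.map (homOfLE (X.basicOpen_le g)).op).hom
  letI : Algebra Γ(X, W) Γ(X, U) := res.toAlgebra
  haveI : IsLocalization.Away g Γ(X, U) := hW.isLocalization_basicOpen g
  obtain ⟨hIU, hqr, -, hregU⟩ := hloc Γ(X, U)
  let f' : Fin c → Γ(X, U) := fun l => res (f l)
  have hf' : Ideal.span (Set.range f') = C.ideal U := by
    rw [show C.ideal U = (C.ideal ⟨W, hW⟩).map res from (C.map_ideal_basicOpen ⟨W, hW⟩ g).symm]
    exact hIU.symm
  have hqr' : IsQuasiRegular f' := hqr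
  haveI : IsRegularRing (Γ(X, U) ⧸ Ideal.span (Set.range f')) := by
    rw [hIU] at hregU
    exact hregU
  -- the chart `V ∋ x'` at a generator `f'_i`
  obtain ⟨i, V, hVU, e, hx'V, he⟩ := hπ.exists_generator_chart U hxU f' hf'
  -- a generator `u ∈ H(U)` of `H_x` of order one, `u = Σ a_l f'_l`
  have hHx : stalkIdeal H (π x') = Ideal.span ((X.presheaf.germ U (π x') hxU).hom '' H.ideal U) := by
    rw [stalkIdeal_eq_map_germ H U hxU, Ideal.map, Ideal.span]
  obtain ⟨_, ⟨u, huH, rfl⟩, hu⟩ := exists_mem_span_singleton_eq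
    (⟨_, ⟨0, (H.ideal U).zero_mem, rfl⟩⟩ : ((X.presheaf.germ U (π x') hxU).hom '' H.ideal U).Nonempty)
    (hHx.symm.trans hv)
  have hu2 : (X.presheaf.germ U (π x') hxU).hom u ∉
      (maximalIdeal (X.presheaf.stalk (π x'))) ^ 2 := notMem_sq_of_span_singleton_eq hu.symm hv2
  have hHu : stalkIdeal H (π x') = Ideal.span {(X.presheaf.germ U (π x') hxU).hom u} := by
    rw [hv, hu]
  have huC : u ∈ Ideal.span (Set.range f') := hf'.symm ▸ hHC U huH
  obtain ⟨a, ha⟩ := Ideal.mem_span_range_iff_exists_fun.mp huC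
  -- the relevant elements of `R' = Γ(X', V)` and of the stalk `S' = 𝒪_{X', x'}`
  have heψ : ∀ s : Γ(X, U), e (π.appLE U V hVU s) =
      reesChartBase (f' i) (Ideal.mem_span_range_self (f := f') (x := i)) s := he
  -- `ψ(f'_l) = ψ(f'_i) · e⁻¹(e_l)`, so `C(U)·R' = (ψ f'_i)`
  -- (equalities in the chart ring are chained in term mode: rewriting with `heψ` inside it is
  -- prohibitively slow for the elaborator)
  have hgen : ∀ l, ∃ q : Γ(X', V), π.appLE U V hVU (f' l) = π.appLE U V hVU (f' i) * q := by
    intro l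
    let El := HomogeneousLocalization.Away.mk (reesGrading (Ideal.span (Set.range f')))
      (reesT_mem (f' i) (Ideal.mem_span_range_self (f := f') (x := i))) 1
      (reesT (f' l) (Ideal.mem_span_range_self (f := f') (x := l))) (reesT_mem_one_smul f' l)
    refine ⟨e.symm El, e.injective ?_⟩
    calc e (π.appLE U V hVU (f' l))
        = reesChartBase (f' i) (Ideal.mem_span_range_self (f := f') (x := i)) (f' l) := heψ _
      _ = reesChartBase (f' i) (Ideal.mem_span_range_self (f := f') (x := i)) (f' i) * El :=
          reesChartBase_apply_eq_mul_chartGen f' i l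
      _ = e (π.appLE U V hVU (f' i)) * e (e.symm El) :=
          congrArg₂ (· * ·) (heψ _).symm (e.apply_symm_apply _).symm
      _ = e (π.appLE U V hVU (f' i) * e.symm El) := (map_mul e _ _).symm
  have hCψ : (C.ideal U).map (π.appLE U V hVU).hom = Ideal.span {π.appLE U V hVU (f' i)} := by
    apply le_antisymm
    · rw [← hf', Ideal.map_span, Ideal.span_le]
      rintro _ ⟨_, ⟨l, rfl⟩, rfl⟩
      obtain ⟨q, hq⟩ := hgen l
      rw [SetLike.mem_coe, Ideal.mem_span_singleton']
      exact ⟨q, by rw [mul_comm]; exact hq.symm⟩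
    · rw [Ideal.span_singleton_le_iff_mem]
      exact Ideal.mem_map_of_mem _ (hf' ▸ Ideal.subset_span ⟨i, rfl⟩)
  -- `ψ u = ψ(f'_i) · w₀`
  have huψ : π.appLE U V hVU u ∈ Ideal.span {π.appLE U V hVU (f' i)} :=
    hCψ ▸ Ideal.mem_map_of_mem _ (hHC U huH)
  obtain ⟨w₀, hw₀⟩ := Ideal.mem_span_singleton'.mp huψ
  have hw₀' : π.appLE U V hVU (f' i) * w₀ = π.appLE U V hVU u := by rw [mul_comm]; exact hw₀
  have hû' : reesChartBase (f' i) (Ideal.mem_span_range_self (f := f') (x := i)) (∑ l, a l * f' l) =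
      reesChartBase (f' i) (Ideal.mem_span_range_self (f := f') (x := i)) (f' i) * e w₀ :=
    calc reesChartBase (f' i) (Ideal.mem_span_range_self (f := f') (x := i)) (∑ l, a l * f' l)
        = reesChartBase (f' i) (Ideal.mem_span_range_self (f := f') (x := i)) u := by rw [ha]
      _ = e (π.appLE U V hVU u) := (heψ u).symm
      _ = e (π.appLE U V hVU (f' i) * w₀) := by rw [hw₀']
      _ = e (π.appLE U V hVU (f' i)) * e w₀ := map_mul e _ _
      _ = reesChartBase (f' i) (Ideal.mem_span_range_self (f := f') (x := i)) (f' i) * e w₀ :=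
          congrArg (fun z => z * e w₀) (heψ (f' i))
  have hchart := chartTransform_notMem_sq' f' i hqr' a (e w₀) hû'
  have hchart₂ := reesChartBase_notMem_span_chartTransform' f' i hqr' a (e w₀) hû'
  -- stalks over `Γ(X', V)`
  letI algV : Algebra Γ(X', V) (X'.presheaf.stalk x') := (X'.presheaf.germ V x' hx'V).hom.toAlgebra
  haveI : IsLocalization.AtPrime (X'.presheaf.stalk x') (V.2.primeIdealOf ⟨x', hx'V⟩).asIdeal :=
    V.2.isLocalization_stalk ⟨x', hx'V⟩
  -- (`obtain` rather than `set`: abstracting the large context is prohibitively slow)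
  obtain ⟨t, htdef⟩ : ∃ t : X'.presheaf.stalk x',
      t = algebraMap Γ(X', V) (X'.presheaf.stalk x') (π.appLE U V hVU (f' i)) := ⟨_, rfl⟩
  obtain ⟨w, hwdef⟩ : ∃ w : X'.presheaf.stalk x',
      w = algebraMap Γ(X', V) (X'.presheaf.stalk x') w₀ := ⟨_, rfl⟩
  have hCst : stalkIdeal (C.comap π) x' = Ideal.span {t} := by
    rw [stalkIdeal_eq_map_germ _ V hx'V, ideal_comap_of_le π C U V hVU, hCψ, Ideal.map_span,
      Set.image_singleton, htdef]
    rfl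
  have hHst : (stalkIdeal H (π x')).map (π.stalkMap x').hom = Ideal.span {t * w} := by
    rw [hHu, Ideal.map_span, Set.image_singleton, htdef, hwdef, ← map_mul, hw₀']
    congr 2
    change (X.presheaf.germ U (π x') hxU ≫ π.stalkMap x') u =
      (π.appLE U V hVU ≫ X'.presheaf.germ V x' hx'V) u
    rw [appLE_germ]
  -- `t` is a nonzerodivisor: the exceptional divisor is Cartier
  have ht : t ∈ nonZeroDivisors (X'.presheaf.stalk x') := by
    obtain ⟨V₀, hx'V₀, g₀, hg₀, hCV₀⟩ := hπ.isEffectiveCartier x'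
    have hCst₀ : stalkIdeal (C.comap π) x' = Ideal.span {(X'.presheaf.germ V₀ x' hx'V₀).hom g₀} := by
      rw [stalkIdeal_eq_map_germ _ V₀ hx'V₀, hCV₀, Ideal.map_span, Set.image_singleton]
    have hg₀' : (X'.presheaf.germ V₀ x' hx'V₀).hom g₀ ∈ nonZeroDivisors (X'.presheaf.stalk x') := by
      letI := (X'.presheaf.germ V₀ x' hx'V₀).hom.toAlgebra
      haveI := V₀.2.isLocalization_stalk ⟨x', hx'V₀⟩
      exact map_mem_nonZeroDivisors_of_isLocalization
        (V₀.2.primeIdealOf ⟨x', hx'V₀⟩).asIdeal.primeCompl (X'.presheaf.stalk x') hg₀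
    exact mem_nonZeroDivisors_of_span_singleton_eq (hCst.symm.trans hCst₀) hg₀'
  have hH'w : stalkIdeal (controlledTransform π C H 1) x' = Ideal.span {w} := by
    rw [hH'st, hHst, hCst, colon_span_mul_span_singleton ht]
  refine ⟨w, hH'w, ?_⟩
  -- `w` is of order one and `t ∉ (w)`: the generic transfers to `B_Q`, `Q = e(𝔮)`, and the chart
  -- computation
  have ht' : t ∈ maximalIdeal (X'.presheaf.stalk x') := by
    refine (Ideal.span_singleton_le_iff_mem _).mp ?_
    rw [← hCst, ← mem_support_iff_stalkIdeal_le, Scheme.IdealSheafData.support_comap]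
    exact hxC
  have hw' : algebraMap Γ(X', V) (X'.presheaf.stalk x') (e.symm (e w₀)) ∈
      maximalIdeal (X'.presheaf.stalk x') := by
    rw [e.symm_apply_apply, ← hwdef]
    exact hwm w hH'w
  have ht'' : algebraMap Γ(X', V) (X'.presheaf.stalk x') (π.appLE U V hVU (f' i)) ∈
      maximalIdeal (X'.presheaf.stalk x') := htdef ▸ ht'
  -- `u` is of order one below: transport from `𝒪_{X, π x'}` to `Γ(X, U)_𝔭`
  have hP : (V.2.primeIdealOf ⟨x', hx'V⟩).asIdeal.comap (π.appLE U V hVU).hom =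
      (U.2.primeIdealOf ⟨π x', hxU⟩).asIdeal := comap_primeIdealOf_appLE π U V hVU x' hx'V
  have hu_key : ∀ (P : Ideal Γ(X, U)) [P.IsPrime], P = (U.2.primeIdealOf ⟨π x', hxU⟩).asIdeal →
      algebraMap Γ(X, U) (Localization.AtPrime P) (∑ l, a l * f' l) ∉
        (maximalIdeal (Localization.AtPrime P)) ^ 2 := by
    rintro P _ rfl
    letI algU : Algebra Γ(X, U) (X.presheaf.stalk (π x')) :=
      (X.presheaf.germ U (π x') hxU).hom.toAlgebra
    haveI : IsLocalization.AtPrime (X.presheaf.stalk (π x'))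
        (U.2.primeIdealOf ⟨π x', hxU⟩).asIdeal := U.2.isLocalization_stalk ⟨π x', hxU⟩
    let ε₀ := IsLocalization.algEquiv (U.2.primeIdealOf ⟨π x', hxU⟩).asIdeal.primeCompl
      (X.presheaf.stalk (π x')) (Localization.AtPrime (U.2.primeIdealOf ⟨π x', hxU⟩).asIdeal)
    have h1 := (notMem_sq_maximalIdeal_iff_of_ringEquiv ε₀.toRingEquiv _).mp hu2
    have h2 : ε₀.toRingEquiv ((X.presheaf.germ U (π x') hxU).hom u) =
        algebraMap Γ(X, U) _ u := ε₀.commutes u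
    rw [h2, ← ha] at h1
    exact h1
  have hu_below : ∀ (P : Ideal Γ(X, U)) [P.IsPrime],
      P = (V.2.primeIdealOf ⟨x', hx'V⟩).asIdeal.comap (π.appLE U V hVU).hom →
      algebraMap Γ(X, U) (Localization.AtPrime P) (∑ l, a l * f' l) ∉
        (maximalIdeal (Localization.AtPrime P)) ^ 2 :=
    fun P _ hPeq => hu_key P (hPeq.trans hP)
  have key := notMem_sq_of_chart (S' := X'.presheaf.stalk x')
    (V.2.primeIdealOf ⟨x', hx'V⟩).asIdeal e (π.appLE U V hVU).hom
    (reesChartBase (f' i) (Ideal.mem_span_range_self (f := f') (x := i))) heψ (f' i) (e w₀)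
    (∑ l, a l * f' l) (fun Q _ hQi hQw hu2 => hchart Q hQi hQw hu2) ht'' hw' hu_below
  have key₂ := notMem_span_of_chart (S' := X'.presheaf.stalk x')
    (V.2.primeIdealOf ⟨x', hx'V⟩).asIdeal e (π.appLE U V hVU).hom
    (reesChartBase (f' i) (Ideal.mem_span_range_self (f := f') (x := i))) heψ (f' i) (e w₀)
    (∑ l, a l * f' l) (fun Q _ hQi hQw hu2 => hchart₂ Q hQi hQw hu2) ht'' hw' hu_below
  rw [e.symm_apply_apply, ← hwdef] at key key₂
  refine ⟨key, fun hle => key₂ ?_⟩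
  rw [← htdef]
  exact hle (hCst ▸ Ideal.mem_span_singleton_self t)

/-- **BGMW Lemma 3.6.4 (4), sheaf level, for a blow-up in the sense of the universal property**
("`u' = σᶜ(u) = y⁻¹σ^*(u)` … `V(u')` is smooth … since `u` is one of the local parameters
describing the center of the blow-up, `u' = u/y` is a parameter; that is, a function of order
one"): let `X` be a locally Noetherian regular scheme, `π : X' → X` a blow-up along `C` with
`V(C)` regular, and `H ⊆ C` an ideal sheaf which at every point `x` of `V(H)` is generated by an
element of order one (`H_x = (v)`, `v ∉ 𝔪_x²`: the ideal of a hypersurface of maximal contact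
through the centre, `MaximalContact.lean`). Then the controlled transform
`H' = (π^*H : 𝓘(D))` (`controlledTransform π C H 1`; locally `(u')`, `u' = y⁻¹π^*u`) is, at every
point `x'` of `V(H')`, generated by an element of order one of the (regular) local ring
`𝒪_{X',x'}` — so `V(H')` is a regular hypersurface. Proof: off the centre `π` is a local
isomorphism and `H' = π^*H`; at a point over the centre, on an affine neighbourhood where `C` is
cut out by a quasi-regular sequence `f` (`exists_isQuasiRegular_away_of_isRegularRing`) and a
chart `Γ(X', V) ≅ (R[It])_{(f_i t)}` (`IsBlowup.exists_generator_chart`), `H_x = (u)` with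
`u = Σ a_l f_l`, `H'_{x'} = ((f_i û) : (f_i)) = (û)` and `û` is of order one by the chart
computation (`chartTransform_notMem_sq`, `HypersurfaceTransformChart.lean`).
[cite: BierstoneGrigorievMilmanWlodarczyk2011, Lemma 3.6.4 (4)] -/
theorem IsBlowup.exists_generator_notMem_sq_controlledTransform (hX : Scheme.IsRegular X)
    (hπ : IsBlowup π C) (hC : Scheme.IsRegular C.subscheme) (hHC : H ≤ C)
    (hH : ∀ x ∈ H.support, ∃ v : X.presheaf.stalk x,
      stalkIdeal H x = Ideal.span {v} ∧ v ∉ (maximalIdeal (X.presheaf.stalk x)) ^ 2)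
    (x' : X') (hx' : x' ∈ (controlledTransform π C H 1).support) :
    ∃ w : X'.presheaf.stalk x', stalkIdeal (controlledTransform π C H 1) x' = Ideal.span {w} ∧
      w ∉ (maximalIdeal (X'.presheaf.stalk x')) ^ 2 := by
  obtain ⟨w, hw, hw2, -⟩ := hπ.exists_generator_controlledTransform_hypersurface hX hC hHC hH x' hx'
  exact ⟨w, hw, hw2⟩

/-- **BGMW Lemma 3.6.4 (4): `V(u')` is a regular hypersurface.** With hypotheses as in
`IsBlowup.exists_generator_notMem_sq_controlledTransform`, at every point `x'` of `V(H')` the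
local ring `𝒪_{X',x'}` is regular (`X'` is regular, Liu Thm. 8.1.19 (a)) and
`𝒪_{X',x'}/H'_{x'}` is a regular local ring with `dim 𝒪_{X',x'}/H'_{x'} + 1 = dim 𝒪_{X',x'}`
(Matsumura Thm. 14.2). [cite: BierstoneGrigorievMilmanWlodarczyk2011, Lemma 3.6.4 (4)] -/
theorem IsBlowup.isRegularLocalRing_quotient_stalkIdeal_controlledTransform
    (hX : Scheme.IsRegular X) (hπ : IsBlowup π C) (hC : Scheme.IsRegular C.subscheme) (hHC : H ≤ C)
    (hH : ∀ x ∈ H.support, ∃ v : X.presheaf.stalk x,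
      stalkIdeal H x = Ideal.span {v} ∧ v ∉ (maximalIdeal (X.presheaf.stalk x)) ^ 2)
    (x' : X') (hx' : x' ∈ (controlledTransform π C H 1).support) :
    IsRegularLocalRing (X'.presheaf.stalk x') ∧
      IsRegularLocalRing (X'.presheaf.stalk x' ⧸ stalkIdeal (controlledTransform π C H 1) x') ∧
      ringKrullDim (X'.presheaf.stalk x' ⧸ stalkIdeal (controlledTransform π C H 1) x') + 1 =
        ringKrullDim (X'.presheaf.stalk x') := by
  haveI : IsRegularLocalRing (X'.presheaf.stalk x') :=
    hπ.isRegular_of_isRegular_subscheme hX hC x'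
  obtain ⟨w, hw, hw2⟩ :=
    hπ.exists_generator_notMem_sq_controlledTransform hX hC hHC hH x' hx'
  have hwm : w ∈ maximalIdeal (X'.presheaf.stalk x') :=
    (Ideal.span_singleton_le_iff_mem _).mp (hw ▸ (mem_support_iff_stalkIdeal_le _ _).mp hx')
  rw [hw]
  exact ⟨‹_›, IsRegularLocalRing.quotient_span_singleton hwm hw2⟩

end Main

end Literature.AlgebraicGeometry.Resolution

end
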